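import Summits.RiemannHypothesis.RiemannHypothesis.Theorems.WeilTwoPrimeDeflC83XBase
import Literature.NumberTheory.LFunctions.WeilBlockRows
import HarnessLib

/-!
# Deflated two-prime certificate C83X: rows 40–47 of the even check `D C = I`

`WeilCert.checkDCRow 0` for certificate C83X, by `decide +kernel`. Pure proof file.
-/

set_option linter.dupNamespace false

noncomputable section

namespace Summit.RiemannHypothesis.RiemannHypothesis.Theorems.EvenWinsBeyondArch

open Literature.NumberTheory.LFunctions

set_option maxHeartbeats 0 in
/-- Kernel check of row 40 of the even `D C = I` (certificate C83X). [folklore] -/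
theorem checkDCRow0_40_weilCertDeflC83X : weilCertDeflC83XBase.checkDCRow 0 40 = true := by
  decide +kernel

set_option maxHeartbeats 0 in
/-- Kernel check of row 41 of the even `D C = I` (certificate C83X). [folklore] -/
theorem checkDCRow0_41_weilCertDeflC83X : weilCertDeflC83XBase.checkDCRow 0 41 = true := by
  decide +kernel

set_option maxHeartbeats 0 in
/-- Kernel check of row 42 of the even `D C = I` (certificate C83X). [folklore] -/
theorem checkDCRow0_42_weilCertDeflC83X : weilCertDeflC83XBase.checkDCRow 0 42 = true := by
  decide +kernel

set_option maxHeartbeats 0 in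
/-- Kernel check of row 43 of the even `D C = I` (certificate C83X). [folklore] -/
theorem checkDCRow0_43_weilCertDeflC83X : weilCertDeflC83XBase.checkDCRow 0 43 = true := by
  decide +kernel

set_option maxHeartbeats 0 in
/-- Kernel check of row 44 of the even `D C = I` (certificate C83X). [folklore] -/
theorem checkDCRow0_44_weilCertDeflC83X : weilCertDeflC83XBase.checkDCRow 0 44 = true := by
  decide +kernel

set_option maxHeartbeats 0 in
/-- Kernel check of row 45 of the even `D C = I` (certificate C83X). [folklore] -/
theorem checkDCRow0_45_weilCertDeflC83X : weilCertDeflC83XBase.checkDCRow 0 45 = true := by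
  decide +kernel

set_option maxHeartbeats 0 in
/-- Kernel check of row 46 of the even `D C = I` (certificate C83X). [folklore] -/
theorem checkDCRow0_46_weilCertDeflC83X : weilCertDeflC83XBase.checkDCRow 0 46 = true := by
  decide +kernel

set_option maxHeartbeats 0 in
/-- Kernel check of row 47 of the even `D C = I` (certificate C83X). [folklore] -/
theorem checkDCRow0_47_weilCertDeflC83X : weilCertDeflC83XBase.checkDCRow 0 47 = true := by
  decide +kernel


end Summit.RiemannHypothesis.RiemannHypothesis.Theorems.EvenWinsBeyondArch
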